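import Summits.Ventures.PercRepro.S2FourteenSevenSpreadSix
import Summits.Ventures.PercRepro.S2FourteenSevenSpreadSeven
import Summits.Ventures.PercRepro.S2FourteenSevenSpreadEight
import Summits.Ventures.PercRepro.S2FourteenSevenSpreadNine
import Summits.Ventures.PercRepro.S2FourteenSevenSpreadTen
import Summits.Ventures.PercRepro.RankLevelSetLevelFiveCqFifteenSpread

/-!
# PercRepro — THEOREM C₅ AT EVERY `p ≥ 15` (p7, gen 14; sub-claim S2): THE CELL `(14, 7)` IS CLOSED

The spread case of the coloop-free cell `(14, 7)` is closed row by row in the number `t ≤ 11` of triangles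
(`S2FourteenSevenSpreadSix` for `t ≤ 6`, `…Seven`, `…Eight`, `…Nine`, `…Ten` for `t ≥ 10`):
**`c025_fourteen_seven_cf_spread`**. With the cases `ν = 6, 5, 4` (`S2FourteenSevenCf`) the coloop-free cell is
**`c025_fourteen_seven_cf`**, with the coloop split (`S2FourteenSeven`) the cell is
**`c025_core_five_fourteen_seven (M) [M.Finite] (hR : ρ(E) = 14) (hn : |E| = 14 + 7) (hfree) : RLS M 14 5`**, and
with `RankLevelSetLevelFiveCqFifteenOne` Theorem C₅ holds at every `p ≥ 15` unconditionally:
**`c025_five_large_sharp15 (M) [M.Finite] (p) (hp : 15 ≤ p) : RLS M p 5`**. No window move is claimed here (the window of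
record stays `8 ≤ p ≤ 15` until the operator moves it). Axioms: standard.
-/

open scoped Matroid

namespace PercRepro

namespace ThmN

open Set

variable {α : Type}

/-- **The spread case of the coloop-free cell `(14, 7)`**, row by row in the number of triangles. -/
theorem c025_fourteen_seven_cf_spread (M : Matroid α) [M.Finite]
    (hR : M.eRank = ((14 : ℕ) : ℕ∞)) (hn : M.E.ncard = 14 + 7)
    (hfree : ∀ e ∈ M.E, ∃ A ⊆ M.E \ {e}, e ∉ M.closure A ∧ e ∉ M.closure ((M.E \ {e}) \ A)) (hK : ∀ e, ¬ M.IsColoop e)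
    (h4 : ¬ ∃ W ⊆ M.E, W.ncard ≤ 9 ∧ W.encard = M.eRk W + 4) : RLS M 14 5 := by
  by_cases ht6 : {C : Set α | M.IsCircuit C ∧ C.ncard = 3}.ncard ≤ 6
  · exact c025_fourteen_seven_cf_spread_le_six M hR hn hfree hK h4 ht6
  by_cases ht7 : {C : Set α | M.IsCircuit C ∧ C.ncard = 3}.ncard = 7
  · exact c025_fourteen_seven_cf_spread_seven M hR hn hfree hK h4 ht7
  by_cases ht8 : {C : Set α | M.IsCircuit C ∧ C.ncard = 3}.ncard = 8
  · exact c025_fourteen_seven_cf_spread_eight M hR hn hfree hK h4 ht8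
  by_cases ht9 : {C : Set α | M.IsCircuit C ∧ C.ncard = 3}.ncard = 9
  · exact c025_fourteen_seven_cf_spread_nine M hR hn hfree hK h4 ht9
  exact c025_fourteen_seven_cf_spread_ge_ten M hR hn hfree hK h4 (by omega)

/-- **The coloop-free cell `(14, 7)`.** -/
theorem c025_fourteen_seven_cf (M : Matroid α) [M.Finite]
    (hR : M.eRank = ((14 : ℕ) : ℕ∞)) (hn : M.E.ncard = 14 + 7)
    (hfree : ∀ e ∈ M.E, ∃ A ⊆ M.E \ {e}, e ∉ M.closure A ∧ e ∉ M.closure ((M.E \ {e}) \ A)) (hK : ∀ e, ¬ M.IsColoop e) :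
    RLS M 14 5 :=
  c025_fourteen_seven_cf_of_spread (fun M _ hR hn hfree hK _ _ h4 => c025_fourteen_seven_cf_spread M hR hn hfree hK h4)
    M hR hn hfree hK

/-- **THE CELL `(14, 7)`**: `RLS M 14 5` on every `e`-free core of rank `14` on `21` points. -/
theorem c025_core_five_fourteen_seven (M : Matroid α) [M.Finite]
    (hR : M.eRank = ((14 : ℕ) : ℕ∞)) (hn : M.E.ncard = 14 + 7)
    (hfree : ∀ e ∈ M.E, ∃ A ⊆ M.E \ {e}, e ∉ M.closure A ∧ e ∉ M.closure ((M.E \ {e}) \ A)) : RLS M 14 5 :=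
  c025_core_five_fourteen_seven_of_spread
    (fun M _ hR hn hfree hK _ _ h4 => c025_fourteen_seven_cf_spread M hR hn hfree hK h4) M hR hn hfree

/-- **THEOREM C₅ AT EVERY `p ≥ 15`**: `RLS M p 5` for every finite matroid and every `p ≥ 15`. -/
theorem c025_five_large_sharp15 (M : Matroid α) [M.Finite] (p : ℕ) (hp : 15 ≤ p) : RLS M p 5 :=
  c025_five_large_sharp15_of_spread
    (fun M _ hR hn hfree hK _ _ h4 => c025_fourteen_seven_cf_spread M hR hn hfree hK h4) M p hp

end ThmN

end PercRepro
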